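import Summits.CriticalPhenomena.Ising3DConformalLimit.Theorems.PrecisionLaplacianDirectCorrelationStableTailPickInversionAux3
import Literature.NumberTheory.LFunctions.DeBruijnNewmanProofs

/-!
# Axis line holomorphy of the Green symbol function, auxiliary file 1:
# the Poisson kernels in a complex angle

Helper file for the sub-stub `stub_slabModeExpDecay_auxAxisLineHol` (brick of `stub_slabModeExpDecay`)
of line `self-energy-pick-inversion`, crux `PrecisionLaplacian.DirectCorrelationStableTail`
(stmt-CriticalPhenomena-4799). Pure theorem file.

For `t ≥ 0` real and a complex angle `w`, the Poisson denominator factorises as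
`1 - 2t cos w + t² = (1 - t e^{iw})(1 - t e^{-iw})`, and `|1 - r e^{ix}|² = 1 - 2r cos x + r² ≥ 1 - c²`
whenever `r ≥ 0` and `cos x ≤ c`; hence `|1 - 2t cos w + t²| ≥ 1 - c²` as soon as `cos (Re w) ≤ c`
(`one_sub_sq_le_norm_poissonDen_cos`). Consequently, for a finite positive measure `μ` on `[0, 1]`,
the Poisson transform in the angle variable `w ↦ ∫ (1 - t²)/(1 - 2t cos w + t²) dμ(t)` and its
conjugate `w ↦ ∫ 2t sin w/(1 - 2t cos w + t²) dμ(t)` are holomorphic on the open region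
`{w | cos (Re w) < 1} = {Re w ∉ 2πℤ}` (dominated holomorphic parameter integrals,
`Literature.Analysis.Complex.differentiableOn_integral_of_dominated`) with the explicit bounds
`μ(ℝ)/(1 - c²)` (resp. `2 e^{Y} μ(ℝ)/(1 - c²)` on `|Im w| ≤ Y`, via `|sin w| ≤ e^{|Im w|}` from
`Literature.NumberTheory.LFunctions.DeBruijnNewmanProofs`) on `{cos (Re w) ≤ c}`, `0 ≤ c < 1`
(registered sub-goal `stub_slabModeExpDecay_auxAxisLineHol2`). The kernels with parameter `-t`
are the translates by `π` (`cos (w + π) = -cos w`). The region `{cos (Re w) ≤ cos δ}` contains every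
`w` with `dist (Re w, 2πℤ) ≥ δ` (`cos_le_cos_of_forall_le_abs_sub`). References: folklore (Poisson
kernel, Herglotz representation); Katznelson, *An introduction to harmonic analysis*, Ch. I.
-/

noncomputable section

namespace Summit.CriticalPhenomena.Ising3DConformalLimit.Cruxes.DirectCorrelationStableTail.SelfEnergyPickInversion

open MeasureTheory Filter Topology Set Real Complex Metric
open scoped BigOperators
open Literature.Analysis.Complex
open Literature.NumberTheory.LFunctions (norm_sin_le_exp_abs_im)

/-! ### Real angles: distance to `2πℤ` and the cosine -/

/-- If `dist (x, 2πℤ) ≥ δ ≥ 0` then `cos x ≤ cos δ`. [folklore] -/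
theorem cos_le_cos_of_forall_le_abs_sub {δ x : ℝ} (hδ : 0 ≤ δ)
    (h : ∀ n : ℤ, δ ≤ |x - 2 * π * n|) : Real.cos x ≤ Real.cos δ := by
  set n : ℤ := toIocDiv Real.two_pi_pos (-π) x with hn
  set x' : ℝ := toIocMod Real.two_pi_pos (-π) x with hx'
  have hmem : x' ∈ Set.Ioc (-π) (-π + 2 * π) := toIocMod_mem_Ioc Real.two_pi_pos (-π) x
  have hxx : x' + n • (2 * π) = x := toIocMod_add_toIocDiv_zsmul Real.two_pi_pos (-π) x
  rw [zsmul_eq_mul] at hxx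
  have hcos : Real.cos x = Real.cos x' := by
    rw [← hxx, Real.cos_add_int_mul_two_pi]
  have habs : δ ≤ |x'| := by
    have := h n
    rwa [← hxx, show x' + (n : ℝ) * (2 * π) - 2 * π * n = x' by ring] at this
  have hle : |x'| ≤ π := abs_le.2 ⟨hmem.1.le, by linarith [hmem.2]⟩
  rw [hcos, ← Real.cos_abs x']
  exact Real.cos_le_cos_of_nonneg_of_le_pi hδ hle habs

/-- The condition `dist (x, 2πℤ) ≥ δ` forces `δ ≤ π`. [folklore] -/
theorem le_pi_of_forall_le_abs_sub {δ x : ℝ} (h : ∀ n : ℤ, δ ≤ |x - 2 * π * n|) : δ ≤ π := by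
  set n : ℤ := toIocDiv Real.two_pi_pos (-π) x with hn
  set x' : ℝ := toIocMod Real.two_pi_pos (-π) x with hx'
  have hmem : x' ∈ Set.Ioc (-π) (-π + 2 * π) := toIocMod_mem_Ioc Real.two_pi_pos (-π) x
  have hxx : x' + n • (2 * π) = x := toIocMod_add_toIocDiv_zsmul Real.two_pi_pos (-π) x
  rw [zsmul_eq_mul] at hxx
  have habs : δ ≤ |x'| := by
    have := h n
    rwa [← hxx, show x' + (n : ℝ) * (2 * π) - 2 * π * n = x' by ring] at this
  have hle : |x'| ≤ π := abs_le.2 ⟨hmem.1.le, by linarith [hmem.2]⟩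
  exact habs.trans hle

/-- The margin is stable along a real segment: if `dist (x, 2πℤ) ≥ d` and `|s| ≤ d - δ` then
`dist (x + s, 2πℤ) ≥ δ`. [folklore] -/
theorem forall_le_abs_add_sub {d δ x s : ℝ} (h : ∀ n : ℤ, d ≤ |x - 2 * π * n|) (hs : |s| ≤ d - δ) :
    ∀ n : ℤ, δ ≤ |x + s - 2 * π * n| := by
  intro n
  have h1 := h n
  have h2 : |x - 2 * π * n| ≤ |x + s - 2 * π * n| + |s| := by
    have := abs_sub (x + s - 2 * π * n) s
    rwa [show x + s - 2 * π * n - s = x - 2 * π * n by ring] at this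
  linarith

/-! ### The Poisson denominator in a complex angle -/

/-- For `r ≥ 0` and `cos x ≤ c`: `1 - c² ≤ 1 - 2r cos x + r²`. [folklore] -/
theorem one_sub_sq_le_poissonDen_real {c x r : ℝ} (hr : 0 ≤ r) (hx : Real.cos x ≤ c) :
    1 - c ^ 2 ≤ 1 - 2 * r * Real.cos x + r ^ 2 := by
  rcases le_or_gt (Real.cos x) 0 with h | h
  · nlinarith [sq_nonneg c, sq_nonneg r, mul_nonneg hr (neg_nonneg.2 h)]
  · nlinarith [sq_nonneg (r - Real.cos x), mul_self_le_mul_self h.le hx]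

/-- `|1 - r e^{ix}|² = 1 - 2r cos x + r²` for real `r, x`. [folklore] -/
theorem norm_one_sub_mul_exp_sq (r x : ℝ) :
    ‖(1 : ℂ) - (r : ℂ) * Complex.exp ((x : ℂ) * I)‖ ^ 2 = 1 - 2 * r * Real.cos x + r ^ 2 := by
  rw [Complex.sq_norm, Complex.normSq_apply]
  have hre : ((1 : ℂ) - (r : ℂ) * Complex.exp ((x : ℂ) * I)).re = 1 - r * Real.cos x := by
    simp [Complex.exp_ofReal_mul_I_re, Complex.exp_ofReal_mul_I_im]
  have him : ((1 : ℂ) - (r : ℂ) * Complex.exp ((x : ℂ) * I)).im = -(r * Real.sin x) := by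
    simp [Complex.exp_ofReal_mul_I_re, Complex.exp_ofReal_mul_I_im]
  rw [hre, him]
  have := Real.sin_sq_add_cos_sq x
  nlinarith [this]

/-- Factorisation of the Poisson denominator: `1 - 2t cos w + t² = (1 - t e^{iw})(1 - t e^{-iw})`.
[folklore] -/
theorem poissonDen_cos_eq_mul (t : ℂ) (w : ℂ) :
    1 - 2 * t * Complex.cos w + t ^ 2 = (1 - t * Complex.exp (w * I)) * (1 - t * Complex.exp (-(w * I))) := by
  have h2 : Complex.exp (w * I) * Complex.exp (-(w * I)) = 1 := by
    rw [← Complex.exp_add, add_neg_cancel, Complex.exp_zero]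
  have hc : 2 * Complex.cos w = Complex.exp (w * I) + Complex.exp (-(w * I)) := by
    rw [Complex.two_cos, neg_mul]
  linear_combination (-t) * hc - t ^ 2 * h2

/-- `t e^{iw} = (t e^{-Im w}) e^{i Re w}` and `t e^{-iw} = (t e^{Im w}) e^{-i Re w}`. [folklore] -/
theorem mul_exp_mul_I_eq (t : ℝ) (w : ℂ) :
    (t : ℂ) * Complex.exp (w * I) = ((t * Real.exp (-w.im) : ℝ) : ℂ) * Complex.exp ((w.re : ℂ) * I) ∧
    (t : ℂ) * Complex.exp (-(w * I)) = ((t * Real.exp w.im : ℝ) : ℂ) * Complex.exp (((-w.re : ℝ) : ℂ) * I) := by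
  constructor
  · have h1 : w * I = ((-w.im : ℝ) : ℂ) + (w.re : ℂ) * I := by
      apply Complex.ext <;> simp
    rw [h1, Complex.exp_add, ← Complex.ofReal_exp]; push_cast; ring
  · have h1 : -(w * I) = ((w.im : ℝ) : ℂ) + ((-w.re : ℝ) : ℂ) * I := by
      apply Complex.ext <;> simp
    rw [h1, Complex.exp_add, ← Complex.ofReal_exp]; push_cast; ring

/-- **Lower bound for the Poisson denominator in a complex angle**: for `t ≥ 0` and
`cos (Re w) ≤ c`, `1 - c² ≤ |1 - 2t cos w + t²|`. [folklore] -/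
theorem one_sub_sq_le_norm_poissonDen_cos {c t : ℝ} (ht : 0 ≤ t) {w : ℂ} (hw : Real.cos w.re ≤ c) :
    1 - c ^ 2 ≤ ‖1 - 2 * (t : ℂ) * Complex.cos w + (t : ℂ) ^ 2‖ := by
  rcases lt_or_ge 1 (c ^ 2) with hc | hc
  · exact le_trans (by linarith) (norm_nonneg _)
  rw [poissonDen_cos_eq_mul, norm_mul, (mul_exp_mul_I_eq t w).1, (mul_exp_mul_I_eq t w).2]
  have k1 := norm_one_sub_mul_exp_sq (t * Real.exp (-w.im)) w.re
  have k2 := norm_one_sub_mul_exp_sq (t * Real.exp w.im) (-w.re)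
  have b1 : 1 - c ^ 2 ≤ ‖(1 : ℂ) - ((t * Real.exp (-w.im) : ℝ) : ℂ) * Complex.exp ((w.re : ℂ) * I)‖ ^ 2 := by
    rw [k1]; exact one_sub_sq_le_poissonDen_real (by positivity) hw
  have b2 : 1 - c ^ 2 ≤ ‖(1 : ℂ) - ((t * Real.exp w.im : ℝ) : ℂ) * Complex.exp (((-w.re : ℝ) : ℂ) * I)‖ ^ 2 := by
    rw [k2, Real.cos_neg]; exact one_sub_sq_le_poissonDen_real (by positivity) hw
  have s1 : Real.sqrt (1 - c ^ 2) ≤ ‖(1 : ℂ) - ((t * Real.exp (-w.im) : ℝ) : ℂ) * Complex.exp ((w.re : ℂ) * I)‖ := by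
    calc Real.sqrt (1 - c ^ 2) ≤ Real.sqrt (‖(1 : ℂ) - ((t * Real.exp (-w.im) : ℝ) : ℂ) *
          Complex.exp ((w.re : ℂ) * I)‖ ^ 2) := Real.sqrt_le_sqrt b1
      _ = _ := Real.sqrt_sq (norm_nonneg _)
  have s2 : Real.sqrt (1 - c ^ 2) ≤ ‖(1 : ℂ) - ((t * Real.exp w.im : ℝ) : ℂ) * Complex.exp (((-w.re : ℝ) : ℂ) * I)‖ := by
    calc Real.sqrt (1 - c ^ 2) ≤ Real.sqrt (‖(1 : ℂ) - ((t * Real.exp w.im : ℝ) : ℂ) *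
          Complex.exp (((-w.re : ℝ) : ℂ) * I)‖ ^ 2) := Real.sqrt_le_sqrt b2
      _ = _ := Real.sqrt_sq (norm_nonneg _)
  calc 1 - c ^ 2 = Real.sqrt (1 - c ^ 2) * Real.sqrt (1 - c ^ 2) := (Real.mul_self_sqrt (by linarith)).symm
    _ ≤ _ := mul_le_mul s1 s2 (Real.sqrt_nonneg _) (norm_nonneg _)

/-- The Poisson denominator in a complex angle does not vanish off `{Re w ∈ 2πℤ}`: for `t ≥ 0` and
`cos (Re w) < 1`, `1 - 2t cos w + t² ≠ 0`. [folklore] -/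
theorem poissonDen_cos_ne_zero {t : ℝ} (ht : 0 ≤ t) {w : ℂ} (hw : Real.cos w.re < 1) :
    1 - 2 * (t : ℂ) * Complex.cos w + (t : ℂ) ^ 2 ≠ 0 := by
  have h := one_sub_sq_le_norm_poissonDen_cos ht (le_max_left (Real.cos w.re) 0)
  have h0 : 0 ≤ max (Real.cos w.re) 0 := le_max_right _ _
  have h1 : max (Real.cos w.re) 0 < 1 := max_lt hw one_pos
  have hpos : 0 < 1 - (max (Real.cos w.re) 0) ^ 2 := by nlinarith
  exact norm_pos_iff.1 (lt_of_lt_of_le hpos h)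

/-- The region `{w | cos (Re w) < c}` is open. [folklore] -/
theorem isOpen_cos_re_lt (c : ℝ) : IsOpen {w : ℂ | Real.cos w.re < c} :=
  isOpen_lt (Real.continuous_cos.comp Complex.continuous_re) continuous_const

/-! ### The Poisson transform in the angle variable -/

/-- **Holomorphy of the Poisson transform in a complex angle.** For a finite positive measure `μ` on
`[0, 1]`, `w ↦ ∫ (1 - t²)/(1 - 2t cos w + t²) dμ(t)` is holomorphic on `{cos (Re w) < 1}`
(dominated holomorphic parameter integral). [folklore] -/
theorem differentiableOn_poissonTransform_cos (μ : Measure ℝ) [IsFiniteMeasure μ]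
    (hμ : μ (Set.Icc (0 : ℝ) 1)ᶜ = 0) :
    DifferentiableOn ℂ (fun w : ℂ => ∫ t, ((1 - t ^ 2 : ℝ) : ℂ) /
      (1 - 2 * (t : ℂ) * Complex.cos w + (t : ℂ) ^ 2) ∂μ) {w : ℂ | Real.cos w.re < 1} := by
  have hae : ∀ᵐ t ∂μ, t ∈ Set.Icc (0 : ℝ) 1 := by
    rw [ae_iff]; simpa only [Set.mem_setOf_eq, ← Set.mem_compl_iff, Set.setOf_mem_eq] using hμ
  apply differentiableOn_integral_of_dominated
  · exact fun w _ => (measurable_poissonIntegrand (Complex.cos w)).aestronglyMeasurable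
  · filter_upwards [hae] with t ht
    exact DifferentiableOn.div (differentiableOn_const _) (by fun_prop)
      fun w hw => poissonDen_cos_ne_zero ht.1 hw
  · intro w₀ hw₀
    have hw₀' : Real.cos w₀.re < 1 := hw₀
    set c₁ : ℝ := max ((1 + Real.cos w₀.re) / 2) 0 with hc₁
    have hc₁w : Real.cos w₀.re < c₁ := lt_max_of_lt_left (by linarith)
    have hc₁0 : 0 ≤ c₁ := le_max_right _ _
    have hc₁1 : c₁ < 1 := max_lt (by linarith) one_pos
    have hpos : 0 < 1 - c₁ ^ 2 := by nlinarith
    obtain ⟨R, hR, hball⟩ := Metric.isOpen_iff.1 (isOpen_cos_re_lt c₁) w₀ hc₁w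
    refine ⟨R, hR, fun w hw => lt_trans (hball hw) hc₁1, fun _ => 1 / (1 - c₁ ^ 2), integrable_const _, ?_⟩
    filter_upwards [hae] with t ht w hw
    exact norm_poissonIntegrand_le ht hpos (one_sub_sq_le_norm_poissonDen_cos ht.1 (le_of_lt (hball hw)))

/-- **Bound for the Poisson transform in a complex angle**: for `0 ≤ c < 1` and `cos (Re w) ≤ c`,
`|∫ (1 - t²)/(1 - 2t cos w + t²) dμ(t)| ≤ μ(ℝ)/(1 - c²)`. [folklore] -/
theorem norm_poissonTransform_cos_le (μ : Measure ℝ) [IsFiniteMeasure μ]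
    (hμ : μ (Set.Icc (0 : ℝ) 1)ᶜ = 0) {c : ℝ} (hc0 : 0 ≤ c) (hc1 : c < 1) {w : ℂ}
    (hw : Real.cos w.re ≤ c) :
    ‖∫ t, ((1 - t ^ 2 : ℝ) : ℂ) / (1 - 2 * (t : ℂ) * Complex.cos w + (t : ℂ) ^ 2) ∂μ‖ ≤
      1 / (1 - c ^ 2) * μ.real Set.univ := by
  have hae : ∀ᵐ t ∂μ, t ∈ Set.Icc (0 : ℝ) 1 := by
    rw [ae_iff]; simpa only [Set.mem_setOf_eq, ← Set.mem_compl_iff, Set.setOf_mem_eq] using hμ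
  have hpos : 0 < 1 - c ^ 2 := by nlinarith
  exact norm_integral_le_of_norm_le_const (hae.mono fun t ht =>
    norm_poissonIntegrand_le ht hpos (one_sub_sq_le_norm_poissonDen_cos ht.1 hw))

/-- The Poisson transform in a real angle is the real Poisson integral. [folklore] -/
theorem poissonTransform_cos_ofReal (μ : Measure ℝ) (x : ℝ) :
    (∫ t, ((1 - t ^ 2 : ℝ) : ℂ) / (1 - 2 * (t : ℂ) * Complex.cos (x : ℂ) + (t : ℂ) ^ 2) ∂μ) =
      ((∫ t, (1 - t ^ 2) / (1 - 2 * t * Real.cos x + t ^ 2) ∂μ : ℝ) : ℂ) := by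
  rw [← Complex.ofReal_cos]
  exact poissonTransform_ofReal μ (Real.cos x)

/-! ### The conjugate Poisson transform in the angle variable -/

/-- Measurability in `t` of the conjugate Poisson integrand `2t sin w/(1 - 2t cos w + t²)`. [folklore] -/
theorem measurable_conjPoissonIntegrand_cos (w : ℂ) :
    Measurable fun t : ℝ => 2 * (t : ℂ) * Complex.sin w / (1 - 2 * (t : ℂ) * Complex.cos w + (t : ℂ) ^ 2) := by
  fun_prop

/-- Bound for the conjugate Poisson integrand: for `t ∈ [0, 1]`, `0 ≤ c` with `cos (Re w) ≤ c < 1` and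
`|Im w| ≤ Y`, `|2t sin w/(1 - 2t cos w + t²)| ≤ 2 e^{Y}/(1 - c²)`. [folklore] -/
theorem norm_conjPoissonIntegrand_cos_le {t : ℝ} (ht : t ∈ Set.Icc (0 : ℝ) 1) {c Y : ℝ} (hc0 : 0 ≤ c)
    (hc1 : c < 1) {w : ℂ} (hw : Real.cos w.re ≤ c) (hY : |w.im| ≤ Y) :
    ‖2 * (t : ℂ) * Complex.sin w / (1 - 2 * (t : ℂ) * Complex.cos w + (t : ℂ) ^ 2)‖ ≤
      2 * Real.exp Y / (1 - c ^ 2) := by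
  have hpos : 0 < 1 - c ^ 2 := by nlinarith
  have hden := one_sub_sq_le_norm_poissonDen_cos ht.1 hw
  rw [norm_div]
  have hnum : ‖2 * (t : ℂ) * Complex.sin w‖ ≤ 2 * Real.exp Y := by
    rw [norm_mul, norm_mul, Complex.norm_real, Real.norm_eq_abs, abs_of_nonneg ht.1]
    have h2 : ‖(2 : ℂ)‖ = 2 := by simp
    rw [h2]
    calc 2 * t * ‖Complex.sin w‖ ≤ 2 * 1 * Real.exp |w.im| := by
          gcongr
          · exact ht.2
          · exact norm_sin_le_exp_abs_im w
      _ ≤ 2 * Real.exp Y := by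
          rw [mul_one]; gcongr
  calc ‖2 * (t : ℂ) * Complex.sin w‖ / ‖1 - 2 * (t : ℂ) * Complex.cos w + (t : ℂ) ^ 2‖
      ≤ (2 * Real.exp Y) / ‖1 - 2 * (t : ℂ) * Complex.cos w + (t : ℂ) ^ 2‖ :=
        div_le_div_of_nonneg_right hnum (norm_nonneg _)
    _ ≤ 2 * Real.exp Y / (1 - c ^ 2) := div_le_div_of_nonneg_left (by positivity) hpos hden

/-- **Holomorphy of the conjugate Poisson transform in a complex angle.** For a finite positive
measure `μ` on `[0, 1]`, `w ↦ ∫ 2t sin w/(1 - 2t cos w + t²) dμ(t)` is holomorphic on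
`{cos (Re w) < 1}`. [folklore] -/
theorem differentiableOn_conjPoissonTransform_cos (μ : Measure ℝ) [IsFiniteMeasure μ]
    (hμ : μ (Set.Icc (0 : ℝ) 1)ᶜ = 0) :
    DifferentiableOn ℂ (fun w : ℂ => ∫ t, 2 * (t : ℂ) * Complex.sin w /
      (1 - 2 * (t : ℂ) * Complex.cos w + (t : ℂ) ^ 2) ∂μ) {w : ℂ | Real.cos w.re < 1} := by
  have hae : ∀ᵐ t ∂μ, t ∈ Set.Icc (0 : ℝ) 1 := by
    rw [ae_iff]; simpa only [Set.mem_setOf_eq, ← Set.mem_compl_iff, Set.setOf_mem_eq] using hμ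
  apply differentiableOn_integral_of_dominated
  · exact fun w _ => (measurable_conjPoissonIntegrand_cos w).aestronglyMeasurable
  · filter_upwards [hae] with t ht
    exact DifferentiableOn.div (by fun_prop) (by fun_prop) fun w hw => poissonDen_cos_ne_zero ht.1 hw
  · intro w₀ hw₀
    have hw₀' : Real.cos w₀.re < 1 := hw₀
    set c₁ : ℝ := max ((1 + Real.cos w₀.re) / 2) 0 with hc₁
    have hc₁w : Real.cos w₀.re < c₁ := lt_max_of_lt_left (by linarith)
    have hc₁0 : 0 ≤ c₁ := le_max_right _ _
    have hc₁1 : c₁ < 1 := max_lt (by linarith) one_pos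
    obtain ⟨R₀, hR₀, hball⟩ := Metric.isOpen_iff.1 (isOpen_cos_re_lt c₁) w₀ hc₁w
    refine ⟨R₀, hR₀, fun w hw => lt_trans (hball hw) hc₁1, fun _ => 2 * Real.exp (|w₀.im| + R₀) / (1 - c₁ ^ 2),
      integrable_const _, ?_⟩
    filter_upwards [hae] with t ht w hw
    refine norm_conjPoissonIntegrand_cos_le ht hc₁0 hc₁1 (le_of_lt (hball hw)) ?_
    have h1 : |w.im - w₀.im| ≤ ‖w - w₀‖ := by
      have := Complex.abs_im_le_norm (w - w₀); rwa [Complex.sub_im] at this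
    have h2 : ‖w - w₀‖ < R₀ := mem_ball_iff_norm.1 hw
    have h3 : |w.im| ≤ |w₀.im| + |w.im - w₀.im| := by
      have := abs_add_le w₀.im (w.im - w₀.im); rwa [add_sub_cancel] at this
    linarith

/-- **Bound for the conjugate Poisson transform in a complex angle**: for `0 ≤ c < 1`,
`cos (Re w) ≤ c` and `|Im w| ≤ Y`, `|∫ 2t sin w/(1 - 2t cos w + t²) dμ(t)| ≤ 2e^{Y} μ(ℝ)/(1 - c²)`.
[folklore] -/
theorem norm_conjPoissonTransform_cos_le (μ : Measure ℝ) [IsFiniteMeasure μ]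
    (hμ : μ (Set.Icc (0 : ℝ) 1)ᶜ = 0) {c Y : ℝ} (hc0 : 0 ≤ c) (hc1 : c < 1) {w : ℂ}
    (hw : Real.cos w.re ≤ c) (hY : |w.im| ≤ Y) :
    ‖∫ t, 2 * (t : ℂ) * Complex.sin w / (1 - 2 * (t : ℂ) * Complex.cos w + (t : ℂ) ^ 2) ∂μ‖ ≤
      2 * Real.exp Y / (1 - c ^ 2) * μ.real Set.univ := by
  have hae : ∀ᵐ t ∂μ, t ∈ Set.Icc (0 : ℝ) 1 := by
    rw [ae_iff]; simpa only [Set.mem_setOf_eq, ← Set.mem_compl_iff, Set.setOf_mem_eq] using hμ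
  exact norm_integral_le_of_norm_le_const (hae.mono fun t ht =>
    norm_conjPoissonIntegrand_cos_le ht hc0 hc1 hw hY)

/-- The conjugate Poisson transform in a real angle is the real conjugate Poisson integral. [folklore] -/
theorem conjPoissonTransform_cos_ofReal (μ : Measure ℝ) (x : ℝ) :
    (∫ t, 2 * (t : ℂ) * Complex.sin (x : ℂ) / (1 - 2 * (t : ℂ) * Complex.cos (x : ℂ) + (t : ℂ) ^ 2) ∂μ) =
      ((∫ t, 2 * t * Real.sin x / (1 - 2 * t * Real.cos x + t ^ 2) ∂μ : ℝ) : ℂ) := by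
  have h : ∀ t : ℝ, 2 * (t : ℂ) * Complex.sin (x : ℂ) / (1 - 2 * (t : ℂ) * Complex.cos (x : ℂ) + (t : ℂ) ^ 2) =
      ((2 * t * Real.sin x / (1 - 2 * t * Real.cos x + t ^ 2) : ℝ) : ℂ) := fun t => by
    push_cast; rfl
  simp_rw [h]
  exact integral_ofReal

/-! ### The kernels with parameter `-t`: translation by `π` -/

/-- `1 - 2t cos (w + π) + t² = 1 + 2t cos w + t²` and `2t sin (w + π) = -(2t sin w)`: the Poisson
kernels with parameter `-t` are the translates by `π` of those with parameter `t`. [folklore] -/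
theorem poissonDen_cos_add_pi (t w : ℂ) :
    1 - 2 * t * Complex.cos (w + π) + t ^ 2 = 1 + 2 * t * Complex.cos w + t ^ 2 ∧
      2 * t * Complex.sin (w + π) = -(2 * t * Complex.sin w) := by
  rw [Complex.cos_add_pi, Complex.sin_add_pi]
  constructor <;> ring

/-- `cos (Re (w + π)) = -cos (Re w)`. [folklore] -/
theorem cos_re_add_pi (w : ℂ) : Real.cos (w + π).re = -Real.cos w.re := by
  rw [Complex.add_re, Complex.ofReal_re, Real.cos_add_pi]

/-! ### Registered form -/

/-- **Registered auxiliary stub `stub_slabModeExpDecay_auxAxisLineHol2`** (sub-goal of the brick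
`stub_slabModeExpDecay_auxAxisLineHol` of `stub_slabModeExpDecay`): the Poisson transform of a finite
positive measure on `[0, 1]` in a complex angle is holomorphic on `{cos (Re w) < 1} = {Re w ∉ 2πℤ}`,
bounded by `μ(ℝ)/(1 - c²)` on `{cos (Re w) ≤ c}` (`0 ≤ c < 1`), and real Poisson integrals at real angles
(`differentiableOn_poissonTransform_cos`, `norm_poissonTransform_cos_le`, `poissonTransform_cos_ofReal`).
[folklore] -/
theorem stub_slabModeExpDecay_auxAxisLineHol2 : ∀ (μ : MeasureTheory.Measure ℝ), MeasureTheory.IsFiniteMeasure μ →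
    μ (Set.Icc (0 : ℝ) 1)ᶜ = 0 →
    DifferentiableOn ℂ (fun w : ℂ => ∫ t : ℝ, (((1 - t ^ 2 : ℝ) : ℂ)) /
      (1 - 2 * (t : ℂ) * Complex.cos w + (t : ℂ) ^ 2) ∂μ) {w : ℂ | Real.cos w.re < 1} ∧
    (∀ (c : ℝ) (w : ℂ), 0 ≤ c → c < 1 → Real.cos w.re ≤ c →
      ‖∫ t : ℝ, (((1 - t ^ 2 : ℝ) : ℂ)) / (1 - 2 * (t : ℂ) * Complex.cos w + (t : ℂ) ^ 2) ∂μ‖ ≤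
        1 / (1 - c ^ 2) * μ.real Set.univ) ∧
    (∀ x : ℝ, (∫ t : ℝ, (((1 - t ^ 2 : ℝ) : ℂ)) / (1 - 2 * (t : ℂ) * Complex.cos (x : ℂ) + (t : ℂ) ^ 2) ∂μ) =
      (((∫ t : ℝ, (1 - t ^ 2) / (1 - 2 * t * Real.cos x + t ^ 2) ∂μ : ℝ)) : ℂ)) :=
  fun μ hfin hμ => by
    haveI := hfin
    exact ⟨differentiableOn_poissonTransform_cos μ hμ,
      fun c w hc0 hc1 hw => norm_poissonTransform_cos_le μ hμ hc0 hc1 hw,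
      fun x => poissonTransform_cos_ofReal μ x⟩

end Summit.CriticalPhenomena.Ising3DConformalLimit.Cruxes.DirectCorrelationStableTail.SelfEnergyPickInversion

end
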